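import Mathlib
import HarnessLib
import Summits.HubbardSuperconductivity.HubbardSuperconductivity.Theorems.KLProgrammeKLRegimeEngineTowerChernoff

/-!
# Route `KLProgramme` — crux K3 ENGINE (stmt-HubbardSuperconductivity-20437), stub (e) proof-input «(e)-D-ROWS», (M4): THE FAR COVARIANCE SOURCE OF THE
# TWO-VOLUME LIPSCHITZ TOWER IN E1'S KIT UNITS — the `hsrc` law row from the far step's first-moment bound (seat hubbard-kl-k3c4-p1 g22; `--supports` 20437;
# DROWS-SCOPE-g22 §7.3 (S-far))

The FAR half of the covariance source (the part `D_f` of the defect covariance supported on the seam zone `Zs × Zs`, read at a pin at distance `≥ R` from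
`Zs`) is bounded at the Grassmann level by `…KLRegimeTwoVolumeFarStep.sum_norm_kernel_effAction_sub_self_le_of_far` (Polchinski's equation along
`s ↦ effAction (s•D_f) W` + mean value): in output degree `n+1`,
`((n+2)(n+3)/2)·(s_D/R)·mL(n+3) + ½·Σ_{a+b=n+1} (a+1)(b+1)·(c_R·(mV(a+1)/R)·nV(b+1) + c_C·nV(a+1)·(mV(b+1)/R))` — FIRST ORDER in `D_f`, two factors of the
interpolated actions `𝒱_s` (even, so only even degrees `a+1 = 2a′`, `b+1 = 2b′`, `a′ + b′ = p + 1` for the output degree `2p`), each a plain pinned profile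
`μ` or a first-moment profile `m̂` (pinned at the output pin).  In E1's dimensionless units (caller's dictionary: `σ_f` = entry sup of `D_f`, `R̂` = the
distance in units of the scale's range, `ĉ_R, ĉ_C` = row/column sums, first moments from the weighted profiles) this file reads that right side into the
`hsrc` row of `EngineV8.towerBornDiff_le_law₄`:

* `geometric_of_fourPiece` (§1) — E1's four-piece profile (`ι₁λ, ι₂λ, ι₃λ², A'λ^{m−1}Q'^m`) is dominated by the SINGLE geometric profile `(4Y/Q')·λ^{m−1}Q'^m`,
  `Y = ι₁λ + ι₂/(2Q') + ι₃/(4Q'²) + A'Q'/4` — harmless for a source term (not iterated);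
* `succ_mul_le_three_mul_four_pow`, `mul_succ_sq_le_two_mul_four_pow` — `(p+1)(2p+3) ≤ 3·4^p`, `p(p+1)² ≤ 2·4^p`;
* **`farSrc_le_law`** (§2) — for single geometric majorants `μ m ≤ Āλ^{m−1}Q̄^m`, `m̂ m ≤ B̄λ^{m−1}Q̄^m` (`1 ≤ m ≤ D+1`), the far-step hypothesis in
  half-degrees and `4Q̄ ≤ Q` (E1's `hu₁` at `Q̄ = Q'`), for `1 ≤ p ≤ D`:
  **`fsrc ≤ s_f · (A λ^{p−1} Q^p)`**, `s_f = Q̄·(3σ_f B̄ λ + (ĉ_R + ĉ_C) Ā B̄)/(R̂·A)` — law-shaped in the degree, the only smallness being `1/R̂ ≍ 2^{J}/R`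
  (DROWS-SCOPE-g22 §7.2 budget).

NOT here: the model dictionary (first moments from `klScaleWt`-weighted profiles, `σ_f`/`ĉ` from `…TwoVolumeBlockDefect.norm_far_le/sum_norm_far_row_le`, the
profiles of `𝒱_s` uniformly in `s` from (b)'s block step at the interpolated covariance).  Pure real analysis; nothing about the model is asserted; nothing
asserts the (D) rows, stub (e), VL, K3 or superconductivity.
References: Benfatto–Giuliani–Mastropietro 2006 §2.8, §3 (3.2)–(3.8) [cite: BenfattoGiulianiMastropietro2006]; Salmhofer 1998 §3.1 Prop. 1, §4.1.
-/

noncomputable section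

namespace Summit.HubbardSuperconductivity.HubbardSuperconductivity.Theorems.TwoVolumeDefect

set_option linter.dupNamespace false -- summit = problem name (single-conjunct summit), D-0017

open Real Finset
open Summit.HubbardSuperconductivity.HubbardSuperconductivity.Theorems.EngineV8

/-! ## §1 One geometric majorant from the four-piece profile; two counting inequalities -/

/-- **The four-piece profile is dominated by one geometric profile**: with `Y = ι₁λ + ι₂/(2Q') + ι₃/(4Q'²) + A'Q'/4`, `0 < Q'`, `0 < λ`,
`μ m ≤ (4Y/Q')·λ^{m−1}·Q'^m` for every `1 ≤ m ≤ D`. -/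
theorem geometric_of_fourPiece {D : ℕ} {μ : ℕ → ℝ} {lam Q' A' ι₁ ι₂ ι₃ : ℝ} (hlam : 0 < lam) (hQ' : 0 < Q') (hA' : 0 ≤ A')
    (hμ0 : ∀ m, 0 ≤ μ m) (hι₁ : μ 1 ≤ ι₁ * lam) (hι₂ : μ 2 ≤ ι₂ * lam) (hι₃ : μ 3 ≤ ι₃ * lam ^ 2)
    (hprof : ∀ m, 4 ≤ m → m ≤ D → μ m ≤ A' * lam ^ (m - 1) * Q' ^ m) {m : ℕ} (hm : 1 ≤ m) (hmD : m ≤ D) :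
    μ m ≤ 4 * (ι₁ * lam + ι₂ / (2 * Q') + ι₃ / (4 * Q' ^ 2) + A' * Q' / 4) / Q' * lam ^ (m - 1) * Q' ^ m := by
  set Y : ℝ := ι₁ * lam + ι₂ / (2 * Q') + ι₃ / (4 * Q' ^ 2) + A' * Q' / 4 with hY
  have hι₁0 : 0 ≤ ι₁ * lam := (hμ0 1).trans hι₁
  have hι₂0 : 0 ≤ ι₂ := by
    by_contra h
    exact absurd ((hμ0 2).trans hι₂) (not_le.2 (mul_neg_of_neg_of_pos (not_le.1 h) hlam))
  have hι₃0 : 0 ≤ ι₃ := by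
    by_contra h
    exact absurd ((hμ0 3).trans hι₃) (not_le.2 (mul_neg_of_neg_of_pos (not_le.1 h) (by positivity)))
  have hY0 : 0 ≤ Y := by rw [hY]; positivity
  have hQ'ne : Q' ≠ 0 := hQ'.ne'
  -- the four pieces of `Y`
  have hA0 : 0 ≤ ι₂ / (2 * Q') := div_nonneg hι₂0 (by positivity)
  have hB0 : 0 ≤ ι₃ / (4 * Q' ^ 2) := div_nonneg hι₃0 (by positivity)
  have hC0 : 0 ≤ A' * Q' / 4 := by positivity
  have hY₁ : ι₁ * lam ≤ Y := by rw [hY]; linarith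
  have hY₂ : ι₂ / (2 * Q') ≤ Y := by rw [hY]; linarith
  have hY₃ : ι₃ / (4 * Q' ^ 2) ≤ Y := by rw [hY]; linarith
  have hY₄ : A' * Q' / 4 ≤ Y := by rw [hY]; linarith
  -- the four constant inequalities
  have h1 : ι₁ * lam ≤ 4 * Y / Q' * Q' := by
    rw [div_mul_cancel₀ _ hQ'ne]; linarith
  have h2 : ι₂ ≤ 4 * Y / Q' * Q' ^ 2 := by
    have h := (div_le_iff₀ (by positivity : (0 : ℝ) < 2 * Q')).1 hY₂
    have heq : 4 * Y / Q' * Q' ^ 2 = 4 * Q' * Y := by field_simp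
    rw [heq]; nlinarith
  have h3 : ι₃ ≤ 4 * Y / Q' * Q' ^ 3 := by
    have h := (div_le_iff₀ (by positivity : (0 : ℝ) < 4 * Q' ^ 2)).1 hY₃
    have heq : 4 * Y / Q' * Q' ^ 3 = 4 * Q' ^ 2 * Y := by field_simp
    rw [heq]; nlinarith
  have h4 : A' ≤ 4 * Y / Q' := by
    rw [le_div_iff₀ hQ']; linarith
  rcases Nat.lt_or_ge m 4 with hlt | hge
  · interval_cases m
    · calc μ 1 ≤ ι₁ * lam := hι₁
        _ ≤ 4 * Y / Q' * Q' := h1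
        _ = 4 * Y / Q' * lam ^ (1 - 1) * Q' ^ 1 := by simp
    · calc μ 2 ≤ ι₂ * lam := hι₂
        _ ≤ (4 * Y / Q' * Q' ^ 2) * lam := mul_le_mul_of_nonneg_right h2 hlam.le
        _ = 4 * Y / Q' * lam ^ (2 - 1) * Q' ^ 2 := by ring
    · calc μ 3 ≤ ι₃ * lam ^ 2 := hι₃
        _ ≤ (4 * Y / Q' * Q' ^ 3) * lam ^ 2 := mul_le_mul_of_nonneg_right h3 (by positivity)
        _ = 4 * Y / Q' * lam ^ (3 - 1) * Q' ^ 3 := by ring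
  · calc μ m ≤ A' * lam ^ (m - 1) * Q' ^ m := hprof m hge hmD
      _ ≤ 4 * Y / Q' * lam ^ (m - 1) * Q' ^ m := by gcongr

/-- `(p+1)(2p+3) ≤ 3·4^p`. -/
theorem succ_mul_le_three_mul_four_pow (p : ℕ) : ((p + 1) * (2 * p + 3) : ℕ) ≤ 3 * 4 ^ p := by
  induction p with
  | zero => norm_num
  | succ p ih =>
    have : (p + 1 + 1) * (2 * (p + 1) + 3) = (p + 1) * (2 * p + 3) + (4 * p + 7) := by ring
    have h4 : 1 ≤ 4 ^ p := Nat.one_le_pow _ _ (by norm_num)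
    rw [this, pow_succ]
    nlinarith

/-- `p(p+1)² ≤ 2·4^p`. -/
theorem mul_succ_sq_le_two_mul_four_pow (p : ℕ) : (p * (p + 1) ^ 2 : ℕ) ≤ 2 * 4 ^ p := by
  induction p with
  | zero => norm_num
  | succ p ih =>
    rcases Nat.lt_or_ge p 2 with hlt | hge
    · interval_cases p <;> norm_num
    · -- `(p+1)(p+2)² ≤ 4·p(p+1)²` for `p ≥ 2`
      have hkey : (p + 1) * (p + 1 + 1) ^ 2 ≤ 4 * (p * (p + 1) ^ 2) := by nlinarith
      calc (p + 1) * (p + 1 + 1) ^ 2 ≤ 4 * (p * (p + 1) ^ 2) := hkey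
        _ ≤ 4 * (2 * 4 ^ p) := Nat.mul_le_mul_left 4 ih
        _ = 2 * 4 ^ (p + 1) := by ring

/-! ## §2 The `hsrc` law row of the far covariance source -/

/-- **THE FAR COVARIANCE SOURCE IS LAW-SHAPED WITH PREFACTOR `1/R̂`** (the `hsrc` row of `towerBornDiff_le_law₄` for the far half of the defect-covariance
step).  For single geometric majorants `μ m ≤ Ā λ^{m−1} Q̄^m` (plain pinned profile) and `m̂ m ≤ B̄ λ^{m−1} Q̄^m` (first-moment profile at the output
pin), `1 ≤ m ≤ D+1`, nonnegative `σ_f, ĉ_R, ĉ_C`, `0 < R̂`, and the far-step hypothesis of `…TwoVolumeFarStep` in half-degrees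
(`fsrc ≤ ((2p+2)(2p+3)/2)·(σ_f/R̂)·m̂(p+1) + ½·Σ_{a′=1}^{p} (2a′)(2(p+1−a′))·(ĉ_R·m̂(a′)·μ(p+1−a′) + ĉ_C·μ(a′)·m̂(p+1−a′))/R̂`), with `4Q̄ ≤ Q`, `0 < A`,
for `1 ≤ p ≤ D`: **`fsrc ≤ s_f · (A λ^{p−1} Q^p)`**, `s_f = Q̄·(3σ_f B̄ λ + (ĉ_R + ĉ_C) Ā B̄)/(R̂·A)`. -/
theorem farSrc_le_law {D : ℕ} {μ mh : ℕ → ℝ} {fsrc σf cR cC Rh lam Abar Bbar Qbar A Q : ℝ}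
    (hσf : 0 ≤ σf) (hcR : 0 ≤ cR) (hcC : 0 ≤ cC) (hRh : 0 < Rh) (hlam : 0 ≤ lam) (hAbar : 0 ≤ Abar) (hBbar : 0 ≤ Bbar) (hQbar : 0 < Qbar)
    (hA : 0 < A) (hμ0 : ∀ m, 0 ≤ μ m) (hmh0 : ∀ m, 0 ≤ mh m)
    (hμ : ∀ m, 1 ≤ m → m ≤ D + 1 → μ m ≤ Abar * lam ^ (m - 1) * Qbar ^ m)
    (hmh : ∀ m, 1 ≤ m → m ≤ D + 1 → mh m ≤ Bbar * lam ^ (m - 1) * Qbar ^ m)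
    (hu₁ : 4 * Qbar ≤ Q) {p : ℕ} (hp : 1 ≤ p) (hpD : p ≤ D)
    (hstep : fsrc ≤ (((2 * p + 2) * (2 * p + 3) : ℕ) : ℝ) / 2 * (σf / Rh) * mh (p + 1) +
      (1 / 2) * ∑ a ∈ Icc 1 p, (((2 * a) * (2 * (p + 1 - a)) : ℕ) : ℝ) *
        (cR * mh a * μ (p + 1 - a) + cC * μ a * mh (p + 1 - a)) / Rh) :
    fsrc ≤ (Qbar * (3 * σf * Bbar * lam + (cR + cC) * Abar * Bbar) / (Rh * A)) * (A * lam ^ (p - 1) * Q ^ p) := by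
  have hQ : 0 < Q := lt_of_lt_of_le (by positivity) hu₁
  set Lw : ℝ := lam ^ (p - 1) * Qbar ^ (p + 1) with hLw
  have hLw0 : 0 ≤ Lw := by positivity
  -- (1) the Laplacian term
  have hmhp : mh (p + 1) ≤ Bbar * lam ^ p * Qbar ^ (p + 1) := by
    have h := hmh (p + 1) (by omega) (by omega)
    simpa only [Nat.add_sub_cancel] using h
  have hc1 : (((2 * p + 2) * (2 * p + 3) : ℕ) : ℝ) / 2 ≤ 3 * (4 : ℝ) ^ p := by
    have h := succ_mul_le_three_mul_four_pow p
    have hcast : (((p + 1) * (2 * p + 3) : ℕ) : ℝ) ≤ ((3 * 4 ^ p : ℕ) : ℝ) := by exact_mod_cast h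
    have heq : (((2 * p + 2) * (2 * p + 3) : ℕ) : ℝ) / 2 = (((p + 1) * (2 * p + 3) : ℕ) : ℝ) := by push_cast; ring
    rw [heq]
    refine hcast.trans (le_of_eq ?_)
    push_cast; ring
  have hT1 : (((2 * p + 2) * (2 * p + 3) : ℕ) : ℝ) / 2 * (σf / Rh) * mh (p + 1) ≤ (3 * (4 : ℝ) ^ p) * (σf / Rh) * (Bbar * lam ^ p * Qbar ^ (p + 1)) := by
    have h0 : 0 ≤ (((2 * p + 2) * (2 * p + 3) : ℕ) : ℝ) / 2 := by positivity
    have := hmh0 (p + 1)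
    gcongr
  -- (2) the bilinear terms
  have hterm : ∀ a ∈ Icc 1 p, (((2 * a) * (2 * (p + 1 - a)) : ℕ) : ℝ) * (cR * mh a * μ (p + 1 - a) + cC * μ a * mh (p + 1 - a)) / Rh ≤
      ((p : ℝ) + 1) ^ 2 * ((cR + cC) * Abar * Bbar * Lw) / Rh := by
    intro a ha
    have ha1 : 1 ≤ a := (mem_Icc.1 ha).1
    have hap : a ≤ p := (mem_Icc.1 ha).2
    -- the binomial-type count
    have hcnt : (((2 * a) * (2 * (p + 1 - a)) : ℕ) : ℝ) ≤ ((p : ℝ) + 1) ^ 2 := by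
      have hsub : ((p + 1 - a : ℕ) : ℝ) = (p : ℝ) + 1 - a := by
        rw [Nat.cast_sub (by omega)]; push_cast; ring
      push_cast
      rw [hsub]
      nlinarith [sq_nonneg (2 * (a : ℝ) - ((p : ℝ) + 1))]
    -- the two products are `≤ Ā B̄ Lw`
    have hexp1 : lam ^ (a - 1) * lam ^ (p + 1 - a - 1) = lam ^ (p - 1) := by
      rw [← pow_add]; congr 1; omega
    have hexp2 : Qbar ^ a * Qbar ^ (p + 1 - a) = Qbar ^ (p + 1) := by
      rw [← pow_add]; congr 1; omega
    have hma : mh a ≤ Bbar * lam ^ (a - 1) * Qbar ^ a := hmh a ha1 (by omega)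
    have hμa : μ a ≤ Abar * lam ^ (a - 1) * Qbar ^ a := hμ a ha1 (by omega)
    have hmb : mh (p + 1 - a) ≤ Bbar * lam ^ (p + 1 - a - 1) * Qbar ^ (p + 1 - a) := hmh (p + 1 - a) (by omega) (by omega)
    have hμb : μ (p + 1 - a) ≤ Abar * lam ^ (p + 1 - a - 1) * Qbar ^ (p + 1 - a) := hμ (p + 1 - a) (by omega) (by omega)
    have hprod1 : mh a * μ (p + 1 - a) ≤ Abar * Bbar * Lw := by
      calc mh a * μ (p + 1 - a) ≤ (Bbar * lam ^ (a - 1) * Qbar ^ a) * (Abar * lam ^ (p + 1 - a - 1) * Qbar ^ (p + 1 - a)) :=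
            mul_le_mul hma hμb (hμ0 _) (by positivity)
        _ = Abar * Bbar * ((lam ^ (a - 1) * lam ^ (p + 1 - a - 1)) * (Qbar ^ a * Qbar ^ (p + 1 - a))) := by ring
        _ = Abar * Bbar * Lw := by rw [hexp1, hexp2]
    have hprod2 : μ a * mh (p + 1 - a) ≤ Abar * Bbar * Lw := by
      calc μ a * mh (p + 1 - a) ≤ (Abar * lam ^ (a - 1) * Qbar ^ a) * (Bbar * lam ^ (p + 1 - a - 1) * Qbar ^ (p + 1 - a)) :=
            mul_le_mul hμa hmb (hmh0 _) (by positivity)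
        _ = Abar * Bbar * ((lam ^ (a - 1) * lam ^ (p + 1 - a - 1)) * (Qbar ^ a * Qbar ^ (p + 1 - a))) := by ring
        _ = Abar * Bbar * Lw := by rw [hexp1, hexp2]
    have hin : cR * mh a * μ (p + 1 - a) + cC * μ a * mh (p + 1 - a) ≤ (cR + cC) * Abar * Bbar * Lw := by
      have h1 : cR * mh a * μ (p + 1 - a) ≤ cR * (Abar * Bbar * Lw) := by
        rw [mul_assoc]; exact mul_le_mul_of_nonneg_left hprod1 hcR
      have h2 : cC * μ a * mh (p + 1 - a) ≤ cC * (Abar * Bbar * Lw) := by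
        rw [mul_assoc]; exact mul_le_mul_of_nonneg_left hprod2 hcC
      linarith
    have hin0 : 0 ≤ cR * mh a * μ (p + 1 - a) + cC * μ a * mh (p + 1 - a) := by
      have := hμ0 a; have := hmh0 a; have := hμ0 (p + 1 - a); have := hmh0 (p + 1 - a); positivity
    rw [div_le_div_iff_of_pos_right hRh]
    exact mul_le_mul hcnt hin hin0 (by positivity)
  have hsum : ∑ a ∈ Icc 1 p, (((2 * a) * (2 * (p + 1 - a)) : ℕ) : ℝ) * (cR * mh a * μ (p + 1 - a) + cC * μ a * mh (p + 1 - a)) / Rh ≤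
      2 * (4 : ℝ) ^ p * ((cR + cC) * Abar * Bbar * Lw) / Rh := by
    refine (sum_le_sum hterm).trans ?_
    rw [sum_const, Nat.card_Icc, Nat.add_sub_cancel, nsmul_eq_mul]
    have hcnt : (p : ℝ) * ((p : ℝ) + 1) ^ 2 ≤ 2 * (4 : ℝ) ^ p := by exact_mod_cast mul_succ_sq_le_two_mul_four_pow p
    have h0 : 0 ≤ ((cR + cC) * Abar * Bbar * Lw) / Rh := by positivity
    calc (p : ℝ) * (((p : ℝ) + 1) ^ 2 * ((cR + cC) * Abar * Bbar * Lw) / Rh)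
        = ((p : ℝ) * ((p : ℝ) + 1) ^ 2) * (((cR + cC) * Abar * Bbar * Lw) / Rh) := by ring
      _ ≤ (2 * (4 : ℝ) ^ p) * (((cR + cC) * Abar * Bbar * Lw) / Rh) := mul_le_mul_of_nonneg_right hcnt h0
      _ = _ := by ring
  -- (3) assemble
  have h4 : (4 * Qbar) ^ p ≤ Q ^ p := pow_le_pow_left₀ (by positivity) hu₁ p
  have hlamp : lam ^ p = lam ^ (p - 1) * lam := by
    obtain ⟨q, rfl⟩ : ∃ q, p = q + 1 := ⟨p - 1, by omega⟩
    rw [Nat.add_sub_cancel, pow_succ]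
  calc fsrc ≤ (((2 * p + 2) * (2 * p + 3) : ℕ) : ℝ) / 2 * (σf / Rh) * mh (p + 1) +
        (1 / 2) * ∑ a ∈ Icc 1 p, (((2 * a) * (2 * (p + 1 - a)) : ℕ) : ℝ) *
          (cR * mh a * μ (p + 1 - a) + cC * μ a * mh (p + 1 - a)) / Rh := hstep
    _ ≤ (3 * (4 : ℝ) ^ p) * (σf / Rh) * (Bbar * lam ^ p * Qbar ^ (p + 1)) + (1 / 2) * (2 * (4 : ℝ) ^ p * ((cR + cC) * Abar * Bbar * Lw) / Rh) := by
        gcongr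
    _ = (Qbar * (3 * σf * Bbar * lam + (cR + cC) * Abar * Bbar) / Rh) * (lam ^ (p - 1) * (4 * Qbar) ^ p) := by
        rw [hLw, hlamp, mul_pow, pow_succ]
        field_simp
    _ ≤ (Qbar * (3 * σf * Bbar * lam + (cR + cC) * Abar * Bbar) / Rh) * (lam ^ (p - 1) * Q ^ p) := by
        have h0 : 0 ≤ Qbar * (3 * σf * Bbar * lam + (cR + cC) * Abar * Bbar) / Rh := by positivity
        gcongr
    _ = (Qbar * (3 * σf * Bbar * lam + (cR + cC) * Abar * Bbar) / (Rh * A)) * (A * lam ^ (p - 1) * Q ^ p) := by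
        field_simp

end Summit.HubbardSuperconductivity.HubbardSuperconductivity.Theorems.TwoVolumeDefect

end
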